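import Summits.BirchSwinnertonDyer.BirchSwinnertonDyer.Theses.SylvesterTwoHeegnerIndex
import Summits.BirchSwinnertonDyer.BirchSwinnertonDyer.Theorems.SylvesterTwoHeegnerIndexCoupledUpperBoundReduction
import Summits.BirchSwinnertonDyer.BirchSwinnertonDyer.Theorems.SylvesterTwoHeegnerIndexCoupledUpperBoundReductionSeven
-- ↑ K3R (two g12, p563747 ACCEPTED 2026-08-27T20:0xZ) + K3R-7 (two g12, p566195 ACCEPTED 2026-08-27T20:12:48Z); async audits D-0009

/-! # Skeleton VARIANT J for crux `UpperOffV0HSYPlus` (stmt-BirchSwinnertonDyer-19804) —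
«COUPLED-PAIR SPLIT BY CONGRUENCE CLASS, NO Yin / toric / (C′) INPUT: the crux = K3-typed ∧ K3*-typed»
(planner bsd-cm-plan g25, D325, 2026-08-27; supersedes VARIANT I 317d4bd840cf7a30 as the skeleton OF RECORD;
VARIANT I's file `Lines/cmframe_variantI.lean` STAYS in the crux folder as the alternative line whose (Y)/(T)/(C′)
layer covers the 𝒱₀(B) members at p ≡ 7 (9) independently of K3*'s LEMMA W2).

WHY A NEW VARIANT.  ROAD (k) («𝒪-linear Kolyvagin over the CM field K = ℚ(ω) at the inert prime 2», line card
`Lines/cmframe-kolyvagin2.md`) delivered, on paper, THEOREM K3 (p ≡ 4 (9), 3 ∉ 𝔽_p^{×3}; memo two v2.18 §64–§66,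
refereed g61 `referee/REFEREE-ROADK-K3-G61.md` 15e1e08958e34d97 PASS on the headline, facts-conditional) and the
CANDIDATE THEOREM K3* (p ≡ 7 (9); memo two v2.19/v2.20 §67–§68; desk (M-K3-7) PENDING at registration time; its
LEMMA W2-c calibrated by the two pre-registered instances (T2′) at (13, 11) [index 9, 2-indivisible] and (T3) at
(7, 11) [index 18 = 2·9, 2-divisible], both HIT as predicted). Their CONCLUSIONS are typed WITHOUT Euler-system
vocabulary by two g12's kernel files K3R (`CoupledUpperBoundAtTwoFourModNine`, p563747) and K3R-7
(`CoupledUpperBoundAtTwoSevenModNine`, p566195), and K3R-7's splice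
`SylvesterTwoCoupledUpperBound.upperOffV0HSYPlus_of_coupledUpperBounds` proves the crux BY NAME from the two typed
conclusions ALONE.  So the honest kernel reading of item 19804 is: crux ⟸ (K3 typed) ∧ (K3* typed), each stub a
class-wide COUPLED 2-part upper bound for the Hu–Shu–Yin pair (E_p, E_{3p²}) on one residue class mod 9, each
EQUIVALENT under the route's facts to `MissingUpperBoundAt B 2` for every member of that class
(`coupledUpperBound_iff_missingUpperBoundAt`, `coupledUpperBoundSeven_iff_missingUpperBoundAt`) — the PRE input
[Yin] arXiv:2607.01744 (VARIANT E/H/I's (Y)) LEAVES the line.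

HONEST FRAMING: a skeleton (sorries only in `stub_*`); closes no item; BSD is not claimed for any curve; K3 is a
PAPER theorem (facts-conditional, flags (h4′)/(h5) of the memo) and K3* a PAPER CANDIDATE — both stubs stay `sorry`
until an Euler-system formalisation exists (not commissioned; XL).  The residue split is NOT cosmetic: the p ≡ 4 (9)
proof uses H¹-vanishing at w = (√−3) for E_p, the p ≡ 7 (9) proof replaces it by LEMMA W1 (descent at w) + LEMMA W2
(every derived CM point is twice another, M_r ≥ 1) — different mechanisms, different referee desks.
-/

set_option linter.dupNamespace false

open scoped Classical
open WeierstrassCurve Literature.NumberTheory.EllipticCurves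

namespace Summit.BirchSwinnertonDyer.BirchSwinnertonDyer.Cruxes.UpperOffV0HSYPlus.CoupledPair

/-- (K3-4) THEOREM K3's typed conclusion on `p ≡ 4 (mod 9)`, `3 ∉ 𝔽_p^{×3}`, granted the route's published facts
(PAPER theorem: memo two v2.18 §64–§66, refereed g61 `referee/REFEREE-ROADK-K3-G61.md` 15e1e08958e34d97 PASS on the
headline; kernel OPEN — no Euler-system vocabulary in the tree): for all globally minimal `B ≅ E_p`, `A ≅ E_{3p²}`,
`ord₂ #Ш(B)[2^∞] + ord₂ #Ш(A)[2^∞] ≤ ord₂(#Ш_an(B)·#Ш_an(A))` (= 2m(p)).  Under the facts EQUIVALENT to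
`MissingUpperBoundAt B 2` for every such member (`SylvesterTwoCoupledUpperBound.coupledUpperBound_iff_missingUpperBoundAt`).
Why it might fail: it is implied by BSD₂ on the class, so only with BSD; the paper proof's residual flags (h4′)/(h5)
(HSY (ES1)/(ES2) at conductor 9pn — discharged for (h3) by write-up a9a07fd5edfb003d, desk (M-h3) PASS).
[sources: memo two v2.18 §57–§66; GrossLMS1991 §3–§10; McCallumLMS1991 §5 Thm 5.4; Kolyvagin1990 Thm A;
HuShuYin2019 Thm 1.3/1.4, Cor 4.4; referee files g59 `REFEREE-ROADK-K2-G59.md`, g60 `REFEREE-MH3-G60.md` /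
`REFEREE-T2PRIME-SCORE-G60.md`, g61 `REFEREE-ROADK-K3-G61.md`] -/
theorem stub_coupledUpperBoundAtTwo_fourModNine :
    Summit.BirchSwinnertonDyer.BirchSwinnertonDyer.Theses.SylvesterTwoHeegnerIndex.PublishedFactsTwoPlus →
      Summit.BirchSwinnertonDyer.BirchSwinnertonDyer.Theorems.SylvesterTwoCoupledUpperBound.CoupledUpperBoundAtTwoFourModNine := by
  sorry

/-- (K3-7) THEOREM K3*'s typed conclusion on `p ≡ 7 (mod 9)`, `3 ∉ 𝔽_p^{×3}`, granted the route's published facts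
(PAPER CANDIDATE: memo two v2.19 §67 + v2.20 §68; desk (M-K3-7) PENDING at registration — the line card carries the
live status; kernel OPEN): the same coupled inequality, right side `2m(p) − 2` by Hu–Shu–Yin's display (i = −2).
Mechanism beyond K3: LEMMA W1 (exact unramified descent at w = (√−3) still holds: `H¹(Gal(K_w/ℚ₃), B(K_w)) = 0`) and
LEMMA W2 (the Artin symbol of √−3 at w fixes every CM point of the conductor-9pn tower by THEOREM C's 3-adic identity
(★) ⇒ every derived point is twice another, `M_r ≥ 1`, every Kolyvagin class Kummer at w); W2-c CALIBRATED by the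
pre-registered instances (T2′) (13, 11): index 9, 2-indivisible (PREREG #7/7A, blind-confirmed df0153a68ec17492) and
(T3) (7, 11): index 18 = 2·9, 2-divisible (PREREG #8 4ad5525490380938, RESULT 2298eebf74576530).  Under the facts
EQUIVALENT to `MissingUpperBoundAt B 2` for every such member
(`SylvesterTwoCoupledUpperBound.coupledUpperBoundSeven_iff_missingUpperBoundAt`); on the 𝒱₀(B) members it carries
the 2-integrality of #Ш_an(E_p) (= (C′), which VARIANT I obtains instead from Yin's display + toric decomposition).
Why it might fail: implied by BSD₂ on the class, so only with BSD; as a PAPER proof — W2's «M_r ≥ 1» at deep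
Kolyvagin primes (exact-order auxiliary class, McCallum Prop 5.2 gap for M_r ≥ 1; Kolyvagin LNM 1479 Prop 8 = acq-08093
not held) and the place-3 tameness input (k7t-c2's (β₃)).
[sources: memo two v2.19 §67, v2.20 §68; HuShuYin2019 Cor 4.4 + (bsd) p. 12; McCallumLMS1991 Thm 5.4; Kolyvagin1990
Thm A; GrossLMS1991; PREREG #7/#7A/#8 + RESULT files in HOME/bsd-cm-two/g11–g12] -/
theorem stub_coupledUpperBoundAtTwo_sevenModNine :
    Summit.BirchSwinnertonDyer.BirchSwinnertonDyer.Theses.SylvesterTwoHeegnerIndex.PublishedFactsTwoPlus →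
      Summit.BirchSwinnertonDyer.BirchSwinnertonDyer.Theorems.SylvesterTwoCoupledUpperBound.CoupledUpperBoundAtTwoSevenModNine := by
  sorry

/-- composition (VARIANT J): the crux BY NAME through K3R-7's splice
`SylvesterTwoCoupledUpperBound.upperOffV0HSYPlus_of_coupledUpperBounds` (p566195), feeding both facts-conditional
stubs the facts binder of the crux itself — no (Y), no (T), no (C′), no PRE input. -/
theorem UpperOffV0HSYPlus_of :
    Summit.BirchSwinnertonDyer.BirchSwinnertonDyer.Theses.SylvesterTwoHeegnerIndex.UpperOffV0HSYPlus :=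
  fun hF =>
    Summit.BirchSwinnertonDyer.BirchSwinnertonDyer.Theorems.SylvesterTwoCoupledUpperBound.upperOffV0HSYPlus_of_coupledUpperBounds
      (stub_coupledUpperBoundAtTwo_fourModNine hF) (stub_coupledUpperBoundAtTwo_sevenModNine hF) hF

end Summit.BirchSwinnertonDyer.BirchSwinnertonDyer.Cruxes.UpperOffV0HSYPlus.CoupledPair
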